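import Literature.Computability.AlgebraicComplexity.BurgisserBooleanPartsA3Steps
import Literature.Computability.AlgebraicComplexity.CircuitDepth
import Literature.Computability.MetaComplexity.FregeProofs
import HarnessLib

/-!
# Degree and weight of an integer circuit in terms of its code length

Topic `Computability/AlgebraicComplexity`. The randomised identity test for the tree's language
`PITLanguage` (`ValiantBooleanBridge.lean`: code words `⟨bin n, encodeArithCircuit n C⟩` of
division-free integer circuits `C : ArithCircuit ℤ (Fin n)` with weighted-sum and product gates of
UNBOUNDED fan-in and BINARY integer constants) evaluates `C` at a random point modulo a random
number; its analysis (Schwartz 1980, Cor. 1 and §3; the tree's reusable form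
`Literature.Computability.Complexity.ModularZeroTest.mem_coRP_of_modularZeroTest`,
`Complexity/RandomizedModularZeroTest.lean`) consumes two bounds on the polynomial `C.eval` in
terms of the LENGTH OF THE CODE of `C`: its total degree is `≤ 2^{d(s)}` and its weight (sum of the
absolute values of the coefficients, Bürgisser's `wt`, the tree's `weight`) is `≤ 2^{2^{h(s)}}` for
polynomials `d, h`. This file proves them, with `d = X` and `h = 2X`:

* §1 `ArithCircuit.totalDegree_eval_le_two_pow_edgeSize` — a circuit with `e` wires (operand
  occurrences in gates, `edgeSize`) computes a polynomial of total degree `≤ 2ᵉ`, over any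
  commutative semiring (depth-free form; the tree has the fan-in-two form
  `totalDegree_eval_le_two_pow_size` and the product-depth form
  `ArithCircuit.totalDegree_eval_le_edgeSize_pow`);
* §2 `ArithCircuit.weight_eval_le_of_constLe` — if all coefficients and constants have absolute
  value `≤ A` (`ArithCircuit.ConstLe A`, `A ≥ 2`) then `wt(C.eval) ≤ A^(2^(e + g))`, `g` the number of
  gates (the tree has the constant-free fan-in-two form `weight_eval_le_two_pow_two_pow_size`; the
  weight algebra `weight_add_le`, `weight_mul_le`, … is reused from `BurgisserBooleanPartsA3Steps.lean`);
* §3 code lengths (`ValiantBooleanBridge.arithCircuitEncoding`):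
  `ArithCircuit.edgeSize_add_size_le_length_encode` (`e + g ≤ |code|`) and
  `ArithCircuit.constLe_two_pow_length_encode` (every constant is `< 2^|code|`);
* §4 the code-length forms: for `s = |encodeArithCircuit n C|`,
  `deg C.eval ≤ 2^s` (`totalDegree_eval_le_two_pow_length_encode`) and
  `wt(C.eval) ≤ 2^(s 2^s) ≤ 2^(2^(2s))` (`weight_eval_le_two_pow_length_encode`,
  `sum_abs_coeff_eval_le_of_length_encode`, the latter in the `∑ |coeff|` currency of
  `mem_coRP_of_modularZeroTest`).

Theorem-only apart from the three bookkeeping predicates `Operand.ConstLe`, `Gate.ConstLe`,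
`ArithCircuit.ConstLe`; no named facts. Honest framing: circuit bookkeeping (the size form of
Bürgisser 2000 TCS, Lemma 2.4, for unbounded fan-in and binary constants); nothing here bears on
`VP` versus `VNP`.

## References

* [Burgisser2000TCS] P. Bürgisser, *Cook's versus Valiant's hypothesis*, Theoret. Comput. Sci. 235
  (2000) 71–88 — §2 p. 76 (the weight `wt`), Lemma 2.4 p. 77 (`deg f ≤ 2^{d*}`,
  `log wt(f) ≤ (d⁺ + 1) 2^{d*} log b`).
* [Schwartz1980] J. T. Schwartz, *Fast probabilistic algorithms for verification of polynomial
  identities*, J. ACM 27 (1980) 701–717 — §3 (straight-line programs: degree and magnitude of the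
  value double exponential in the length, hence evaluation modulo random numbers).
* [KabanetsImpagliazzo2004] V. Kabanets, R. Impagliazzo, Comput. Complexity 13 (2004) 1–46, §2
  (circuits as strings; the tree's `arithCircuitEncoding`).
-/

noncomputable section

open MvPolynomial Computability
open Literature.Computability.Complexity

namespace Literature.Computability.AlgebraicComplexity

universe v

namespace ArithCircuit

/-! ## §1 Degree `≤ 2^wires` (unbounded fan-in) -/

section Degree

variable {k : Type*} [CommSemiring k] {σ : Type v}

/-- Total degree of a list product under a uniform bound: `≤ |l| · n`. [folklore] -/
private theorem totalDegree_list_prod_le_of_forall {n : ℕ} (l : List (MvPolynomial σ k))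
    (h : ∀ p ∈ l, p.totalDegree ≤ n) : l.prod.totalDegree ≤ l.length * n := by
  refine (totalDegree_list_prod l).trans ?_
  have : (l.map totalDegree).sum ≤ (l.map fun _ => n).sum :=
    List.sum_le_sum fun p hp => h p hp
  simpa using this

/-- **Gate values have total degree `≤ 2^(wires so far)`** (a sum gate does not raise the bound; a
product gate of fan-in `f` multiplies it by `f ≤ 2^f`). [cite: Burgisser2000TCS, Lemma 2.4 p. 77] -/
theorem totalDegree_le_of_mem_gateValues_edgeSize :
    ∀ (gs : List (Gate k σ)), ∀ v ∈ gateValues gs, v.totalDegree ≤ 2 ^ (gs.map Gate.fanIn).sum := by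
  intro gs
  induction gs using List.reverseRecOn with
  | nil => simp [gateValues]
  | append_singleton gs g ih =>
    intro v hv
    rw [gateValues_append_singleton, List.mem_append, List.mem_singleton] at hv
    have hmono : 2 ^ (gs.map Gate.fanIn).sum ≤ 2 ^ ((gs ++ [g]).map Gate.fanIn).sum :=
      Nat.pow_le_pow_right (by norm_num) (by simp)
    rcases hv with hv | rfl
    · exact (ih v hv).trans hmono
    · -- the new gate
      set D := 2 ^ (gs.map Gate.fanIn).sum with hD
      have hD1 : 1 ≤ D := Nat.one_le_two_pow
      have hops : ∀ u : Operand k σ, (u.eval (gateValues gs)).totalDegree ≤ D :=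
        fun u => totalDegree_operandEval_le hD1 ih u
      have hsum : ((gs ++ [g]).map Gate.fanIn).sum = (gs.map Gate.fanIn).sum + g.fanIn := by simp
      rw [hsum, pow_add]
      cases g with
      | sum args =>
        rw [Gate.eval]
        refine (totalDegree_list_sum_le_of_forall_le _ fun p hp => ?_).trans (Nat.le_mul_of_pos_right _ (by positivity))
        obtain ⟨a, -, rfl⟩ := List.mem_map.1 hp
        exact (totalDegree_smul_le _ _).trans (hops a.2)
      | prod args =>
        rw [Gate.eval]
        have h1 : (args.map fun u : Operand k σ => u.eval (gateValues gs)).prod.totalDegree ≤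
            (args.map fun u : Operand k σ => u.eval (gateValues gs)).length * D :=
          totalDegree_list_prod_le_of_forall _ fun p hp => by
            obtain ⟨u, -, rfl⟩ := List.mem_map.1 hp
            exact hops u
        refine h1.trans ?_
        rw [List.length_map, mul_comm]
        refine Nat.mul_le_mul_left _ ?_
        change args.length ≤ 2 ^ (Gate.prod args).args.length
        exact (Nat.lt_two_pow_self).le

/-- **Degree `≤ 2^wires`.** A circuit with `e = edgeSize` operand occurrences in its gates computes a
polynomial of total degree at most `2ᵉ` (depth-free form of `deg f ≤ 2^{d*}`; the fan-in-two size form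
is `totalDegree_eval_le_two_pow_size`). [cite: Burgisser2000TCS, Lemma 2.4 p. 77] -/
theorem totalDegree_eval_le_two_pow_edgeSize (C : ArithCircuit k σ) :
    C.eval.totalDegree ≤ 2 ^ C.edgeSize :=
  totalDegree_operandEval_le Nat.one_le_two_pow (totalDegree_le_of_mem_gateValues_edgeSize C.gates) C.output

end Degree

/-! ## §2 Weight `≤ A^(2^(wires + gates))` for constants of absolute value `≤ A` -/

section Weight

variable {σ : Type v}

/-- The constant of an operand (if any) has absolute value `≤ A`. [cite: Burgisser2000TCS, Lemma 2.4 p. 77] -/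
def Operand.ConstLe (A : ℕ) : Operand ℤ σ → Prop
  | .const c => c.natAbs ≤ A
  | _ => True

/-- All coefficients and constants of a gate have absolute value `≤ A`. [cite: Burgisser2000TCS, Lemma 2.4 p. 77] -/
def Gate.ConstLe (A : ℕ) : Gate ℤ σ → Prop
  | .sum args => ∀ a ∈ args, a.1.natAbs ≤ A ∧ a.2.ConstLe A
  | .prod args => ∀ u ∈ args, u.ConstLe A

/-- All coefficients and constants of an integer circuit (gates and output operand) have absolute
value `≤ A` (Bürgisser's "integer constants of absolute value `≤ b`"). [cite: Burgisser2000TCS, Lemma 2.4 p. 77] -/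
def ConstLe (A : ℕ) (C : ArithCircuit ℤ σ) : Prop :=
  (∀ g ∈ C.gates, g.ConstLe A) ∧ C.output.ConstLe A

/-- `Operand.ConstLe` is monotone in the bound `b`. [cite: Burgisser2000TCS, Lemma 2.4 p. 77] -/
theorem Operand.ConstLe.mono {A A' : ℕ} (h : A ≤ A') {u : Operand ℤ σ} (hu : u.ConstLe A) :
    u.ConstLe A' := by
  cases u with
  | var _ => trivial
  | const c => exact le_trans hu h
  | gate _ => trivial

/-- `Gate.ConstLe` is monotone in the bound `b`. [cite: Burgisser2000TCS, Lemma 2.4 p. 77] -/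
theorem Gate.ConstLe.mono {A A' : ℕ} (h : A ≤ A') {g : Gate ℤ σ} (hg : g.ConstLe A) : g.ConstLe A' := by
  cases g with
  | sum args => exact fun a ha => ⟨(hg a ha).1.trans h, (hg a ha).2.mono h⟩
  | prod args => exact fun u hu => (hg u hu).mono h

/-- `ConstLe` is monotone in the bound `b`. [cite: Burgisser2000TCS, Lemma 2.4 p. 77] -/
theorem ConstLe.mono {A A' : ℕ} (h : A ≤ A') {C : ArithCircuit ℤ σ} (hC : C.ConstLe A) : C.ConstLe A' :=
  ⟨fun g hg => (hC.1 g hg).mono h, hC.2.mono h⟩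

/-- `wt(c • f) ≤ |c| · wt(f)`. [cite: Burgisser2000TCS, §2 p. 76] -/
theorem weight_smul_le (c : ℤ) (f : MvPolynomial σ ℤ) : weight (c • f) ≤ c.natAbs * weight f := by
  rw [smul_eq_C_mul]
  exact (weight_mul_le _ _).trans (by rw [weight_C])

/-- An operand with constant `≤ A`, read against values of weight `≤ W` (`A ≤ W`, `1 ≤ W`), has
weight `≤ W`. [cite: Burgisser2000TCS, Lemma 2.4 p. 77] -/
theorem weight_operandEval_le_of_constLe {vals : List (MvPolynomial σ ℤ)} {A W : ℕ} (hW : 1 ≤ W)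
    (hAW : A ≤ W) (hvals : ∀ v ∈ vals, weight v ≤ W) {u : Operand ℤ σ} (hu : u.ConstLe A) :
    weight (u.eval vals) ≤ W := by
  cases u with
  | var i => simpa [Operand.eval] using hW
  | const c =>
    simp only [Operand.eval, weight_C]
    exact le_trans hu hAW
  | gate j =>
    simp only [Operand.eval_gate, List.getD_eq_getElem?_getD]
    cases hj : vals[j]? with
    | none => simp
    | some v => exact hvals v (List.mem_of_getElem? hj)

/-- Arithmetic of the weight recursion: `f · (A · W) ≤ A^(E · 2^(f+1))` for `W = A^E`, `A ≥ 2`,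
`E ≥ 1`. [folklore] -/
private theorem mul_mul_pow_le_pow_heightStep {A : ℕ} (hA : 2 ≤ A) {E : ℕ} (hE : 1 ≤ E) (f : ℕ) :
    f * (A * A ^ E) ≤ A ^ (E * 2 ^ (f + 1)) := by
  have hf : f ≤ A ^ f := (Nat.lt_two_pow_self).le.trans (Nat.pow_le_pow_left hA f)
  calc f * (A * A ^ E) ≤ A ^ f * (A * A ^ E) := Nat.mul_le_mul_right _ hf
    _ = A ^ (f + 1 + E) := by rw [pow_add, pow_add, pow_one]; ring
    _ ≤ A ^ (E * 2 ^ (f + 1)) := by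
        refine Nat.pow_le_pow_right (by omega) ?_
        have h2 : f + 2 ≤ 2 ^ (f + 1) := by
          have := @Nat.lt_two_pow_self (f + 1)
          omega
        calc f + 1 + E ≤ E * (f + 2) := by nlinarith
          _ ≤ E * 2 ^ (f + 1) := Nat.mul_le_mul_left E h2

/-- **Gate values have small weight**: with all coefficients and constants `≤ A` (`A ≥ 2`), every
value of a gate list over `ℤ` has weight `≤ A^(2^(wires + gates))` (`wt(Σ cᵢ uᵢ) ≤ Σ |cᵢ| wt(uᵢ)`,
`wt(∏ uᵢ) ≤ ∏ wt(uᵢ)`). [cite: Burgisser2000TCS, Lemma 2.4 p. 77] -/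
theorem weight_le_of_mem_gateValues_of_constLe {A : ℕ} (hA : 2 ≤ A) :
    ∀ (gs : List (Gate ℤ σ)), (∀ g ∈ gs, g.ConstLe A) →
      ∀ v ∈ gateValues gs, weight v ≤ A ^ 2 ^ ((gs.map Gate.fanIn).sum + gs.length) := by
  have hA1 : 1 ≤ A := le_trans (by norm_num) hA
  intro gs
  induction gs using List.reverseRecOn with
  | nil => simp [gateValues]
  | append_singleton gs g ih =>
    intro hgs v hv
    have hgs' : ∀ g' ∈ gs, g'.ConstLe A := fun g' hg' => hgs g' (List.mem_append_left _ hg')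
    have hg : g.ConstLe A := hgs g (by simp)
    rw [gateValues_append_singleton, List.mem_append, List.mem_singleton] at hv
    set E := 2 ^ ((gs.map Gate.fanIn).sum + gs.length) with hEdef
    have hE1 : 1 ≤ E := Nat.one_le_two_pow
    have hexp : ((gs ++ [g]).map Gate.fanIn).sum + (gs ++ [g]).length =
        ((gs.map Gate.fanIn).sum + gs.length) + (g.fanIn + 1) := by
      simp only [List.map_append, List.map_cons, List.map_nil, List.sum_append, List.sum_cons,
        List.sum_nil, List.length_append, List.length_singleton]
      ring
    have hE' : 2 ^ (((gs ++ [g]).map Gate.fanIn).sum + (gs ++ [g]).length) = E * 2 ^ (g.fanIn + 1) := by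
      rw [hexp, pow_add]
    rw [hE']
    have hAE : A ≤ A ^ E := by
      calc A = A ^ 1 := (pow_one A).symm
        _ ≤ A ^ E := Nat.pow_le_pow_right hA1 hE1
    rcases hv with hv | rfl
    · refine (ih hgs' v hv).trans (Nat.pow_le_pow_right hA1 ?_)
      exact Nat.le_mul_of_pos_right E (by positivity)
    · have hops : ∀ u : Operand ℤ σ, u.ConstLe A → weight (u.eval (gateValues gs)) ≤ A ^ E :=
        fun u hu => weight_operandEval_le_of_constLe (Nat.one_le_pow _ _ hA1) hAE (ih hgs') hu
      cases g with
      | sum args =>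
        rw [Gate.eval]
        refine (weight_list_sum_le _).trans ?_
        rw [List.map_map]
        have hterm : ∀ x ∈ args.map (weight ∘ fun p : ℤ × Operand ℤ σ => p.1 • p.2.eval (gateValues gs)),
            x ≤ A * A ^ E := by
          intro x hx
          obtain ⟨p, hp, rfl⟩ := List.mem_map.1 hx
          simp only [Function.comp_apply]
          exact (weight_smul_le _ _).trans (Nat.mul_le_mul (hg p hp).1 (hops p.2 (hg p hp).2))
        refine (List.sum_le_card_nsmul _ _ hterm).trans ?_
        have hf : (Gate.sum args).fanIn = args.length := by simp [Gate.fanIn, Gate.args]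
        rw [List.length_map, smul_eq_mul, hf]
        exact mul_mul_pow_le_pow_heightStep hA hE1 _
      | prod args =>
        rw [Gate.eval]
        refine (weight_list_prod_le _).trans ?_
        rw [List.map_map]
        have hterm : ∀ x ∈ args.map (weight ∘ fun u : Operand ℤ σ => u.eval (gateValues gs)), x ≤ A ^ E := by
          intro x hx
          obtain ⟨u, hu, rfl⟩ := List.mem_map.1 hx
          exact hops u (hg u hu)
        refine (List.prod_le_pow_card _ _ hterm).trans ?_
        rw [List.length_map, ← pow_mul]
        refine Nat.pow_le_pow_right hA1 (Nat.mul_le_mul_left E ?_)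
        change (Gate.prod args).args.length ≤ 2 ^ ((Gate.prod args).args.length + 1)
        exact (Nat.lt_two_pow_self).le.trans (Nat.pow_le_pow_right (by norm_num) (Nat.le_succ _))

/-- **Weight bound** (size form of Bürgisser 2000 TCS, Lemma 2.4, unbounded fan-in, constants
`≤ A`, `A ≥ 2`): `wt(C.eval) ≤ A^(2^(edgeSize C + size C))` — the coefficients of the computed
polynomial have `(e + g)`-exponential bit-size, the reason the identity test evaluates modulo a
random number. [cite: Burgisser2000TCS, Lemma 2.4 p. 77] [cite: Schwartz1980, §3] -/
theorem weight_eval_le_of_constLe (C : ArithCircuit ℤ σ) {A : ℕ} (hA : 2 ≤ A) (hC : C.ConstLe A) :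
    weight C.eval ≤ A ^ 2 ^ (C.edgeSize + C.size) := by
  have hA1 : 1 ≤ A := le_trans (by norm_num) hA
  have hAE : A ≤ A ^ 2 ^ (C.edgeSize + C.size) := by
    calc A = A ^ 1 := (pow_one A).symm
      _ ≤ _ := Nat.pow_le_pow_right hA1 Nat.one_le_two_pow
  exact weight_operandEval_le_of_constLe (Nat.one_le_pow _ _ hA1) hAE
    (weight_le_of_mem_gateValues_of_constLe hA C.gates hC.1) hC.2

/-- The weight in the currency `∑ |coeff|` over `ℤ`. [cite: Burgisser2000TCS, §2 p. 76] -/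
theorem natCast_weight (f : MvPolynomial σ ℤ) : (weight f : ℤ) = ∑ m ∈ f.support, |f.coeff m| := by
  rw [weight, Nat.cast_sum]
  exact Finset.sum_congr rfl fun m _ => Int.natCast_natAbs _

end Weight

/-! ## §3 Code lengths -/

section CodeLength

/-- `n < 2^|bin n|`. [folklore] -/
private theorem lt_two_pow_length_encodeNat (n : ℕ) : n < 2 ^ (encodeNat n).length := by
  simpa using bitsToNat_lt (encodeNat n)

/-- Every item's code is no longer than the list code (private copy of
`Literature.Barriers.CriticalPhenomena.GridSAW.length_encode_le_length_encode_listBool`,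
`Barriers/CriticalPhenomena/GridSAWCountingMembership.lean`, kept out of this file's import cone;
the length formula itself is `Literature.Computability.MetaComplexity.length_encode_listBool`). [folklore] -/
private theorem length_encode_le_length_listBool_encode {α : Type} (e : Encoding α Bool) {l : List α} {a : α}
    (ha : a ∈ l) : (e.encode a).length ≤ (e.listBool.encode l).length := by
  rw [MetaComplexity.length_encode_listBool]
  have : 2 * (e.encode a).length + 2 ≤ (l.map fun a => 2 * (e.encode a).length + 2).sum :=
    List.single_le_sum (fun _ _ => Nat.zero_le _) _ (List.mem_map.2 ⟨a, ha, rfl⟩)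
  omega

variable (n : ℕ)

/-- Fan-in versus code length of a gate: `fanIn g + 1 ≤ |code g|`. [cite: KabanetsImpagliazzo2004, §2] -/
theorem fanIn_succ_le_length_gateEncoding (g : Gate ℤ (Fin n)) :
    g.fanIn + 1 ≤ ((gateEncoding n).encode g).length := by
  cases g with
  | sum args =>
    change (args.map Prod.snd).length + 1 ≤ (false :: (encodingIntBool.pairBool (operandEncoding n)).listBool.encode args).length
    rw [List.length_cons, List.length_map, MetaComplexity.length_encode_listBool]
    omega
  | prod args =>
    change args.length + 1 ≤ (true :: (operandEncoding n).listBool.encode args).length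
    rw [List.length_cons, MetaComplexity.length_encode_listBool]
    omega

/-- **Wires and gates versus code length**: `edgeSize C + size C ≤ |encodeArithCircuit n C|`.
[cite: KabanetsImpagliazzo2004, §2] -/
theorem edgeSize_add_size_le_length_encode (C : ArithCircuit ℤ (Fin n)) :
    C.edgeSize + C.size ≤ (encodeArithCircuit n C).length := by
  change (C.gates.map Gate.fanIn).sum + C.gates.length ≤
    (boolPair ((gateEncoding n).listBool.encode C.gates) ((operandEncoding n).encode C.output)).length
  rw [length_boolPair, MetaComplexity.length_encode_listBool]
  have h : (C.gates.map Gate.fanIn).sum + C.gates.length ≤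
      (C.gates.map fun g => 2 * ((gateEncoding n).encode g).length + 2).sum := by
    have h1 : (C.gates.map fun g => g.fanIn + 1).sum ≤ (C.gates.map fun g => 2 * ((gateEncoding n).encode g).length + 2).sum :=
      List.sum_le_sum fun g _ => by have := fanIn_succ_le_length_gateEncoding n g; omega
    have h2 : (C.gates.map fun g => g.fanIn + 1).sum = (C.gates.map Gate.fanIn).sum + C.gates.length := by
      rw [List.sum_map_add]; simp
    omega
  omega

/-- **A code has at least two symbols** (the separator of the outer pair). [folklore] -/
private theorem two_le_length_encode (C : ArithCircuit ℤ (Fin n)) : 2 ≤ (encodeArithCircuit n C).length := by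
  change 2 ≤ (boolPair ((gateEncoding n).listBool.encode C.gates) ((operandEncoding n).encode C.output)).length
  rw [length_boolPair]
  omega

/-- The constant of an operand is below `2^|code of the operand|`. [cite: KabanetsImpagliazzo2004, §2] -/
theorem Operand.constLe_two_pow_length_encode (u : Operand ℤ (Fin n)) :
    u.ConstLe (2 ^ ((operandEncoding n).encode u).length) := by
  cases u with
  | var _ => trivial
  | gate _ => trivial
  | const c =>
    change c.natAbs ≤ 2 ^ (false :: true :: encodingIntBool.encode c).length
    have hlen : (encodeNat c.natAbs).length ≤ (false :: true :: encodingIntBool.encode c).length := by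
      change (encodeNat c.natAbs).length ≤ (false :: true :: boolPair (encodeBool (decide (c < 0))) (encodeNat c.natAbs)).length
      simp only [List.length_cons, length_boolPair]
      omega
    exact (lt_two_pow_length_encodeNat c.natAbs).le.trans (Nat.pow_le_pow_right (by norm_num) hlen)

/-- Coefficients and operand constants of a gate are below `2^|code of the gate|`.
[cite: KabanetsImpagliazzo2004, §2] -/
theorem Gate.constLe_two_pow_length_encode (g : Gate ℤ (Fin n)) :
    g.ConstLe (2 ^ ((gateEncoding n).encode g).length) := by
  cases g with
  | sum args =>
    intro a ha
    have hitem : ((encodingIntBool.pairBool (operandEncoding n)).encode a).length ≤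
        ((gateEncoding n).encode (Gate.sum args)).length := by
      change _ ≤ (false :: (encodingIntBool.pairBool (operandEncoding n)).listBool.encode args).length
      rw [List.length_cons]
      exact (length_encode_le_length_listBool_encode _ ha).trans (Nat.le_succ _)
    have hpair : ((encodingIntBool.pairBool (operandEncoding n)).encode a).length =
        2 * (encodingIntBool.encode a.1).length + 2 + ((operandEncoding n).encode a.2).length := length_boolPair _ _
    refine ⟨?_, (Operand.constLe_two_pow_length_encode n a.2).mono (Nat.pow_le_pow_right (by norm_num) (by omega))⟩
    have hlen : (encodeNat a.1.natAbs).length ≤ (encodingIntBool.encode a.1).length := by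
      change (encodeNat a.1.natAbs).length ≤ (boolPair (encodeBool (decide (a.1 < 0))) (encodeNat a.1.natAbs)).length
      simp only [length_boolPair]
      omega
    exact (lt_two_pow_length_encodeNat a.1.natAbs).le.trans (Nat.pow_le_pow_right (by norm_num) (by omega))
  | prod args =>
    intro u hu
    refine (Operand.constLe_two_pow_length_encode n u).mono (Nat.pow_le_pow_right (by norm_num) ?_)
    change _ ≤ (true :: (operandEncoding n).listBool.encode args).length
    rw [List.length_cons]
    exact (length_encode_le_length_listBool_encode _ hu).trans (Nat.le_succ _)

/-- **All constants are below `2^|code|`.** [cite: KabanetsImpagliazzo2004, §2] -/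
theorem constLe_two_pow_length_encode (C : ArithCircuit ℤ (Fin n)) :
    C.ConstLe (2 ^ (encodeArithCircuit n C).length) := by
  have hC : (encodeArithCircuit n C).length =
      2 * ((gateEncoding n).listBool.encode C.gates).length + 2 + ((operandEncoding n).encode C.output).length :=
    length_boolPair _ _
  refine ⟨fun g hg => (Gate.constLe_two_pow_length_encode n g).mono (Nat.pow_le_pow_right (by norm_num) ?_),
    (Operand.constLe_two_pow_length_encode n C.output).mono (Nat.pow_le_pow_right (by norm_num) (by omega))⟩
  have := length_encode_le_length_listBool_encode (gateEncoding n) hg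
  omega

end CodeLength

/-! ## §4 The bounds in terms of the code length -/

section CodeForm

variable (n : ℕ) (C : ArithCircuit ℤ (Fin n))

/-- **`deg C.eval ≤ 2^|code C|`** (the hypothesis `hdeg` of `mem_coRP_of_modularZeroTest` with
`d = X`, up to monotonicity in the input length). [cite: Schwartz1980, §3] -/
theorem totalDegree_eval_le_two_pow_length_encode :
    C.eval.totalDegree ≤ 2 ^ (encodeArithCircuit n C).length :=
  (totalDegree_eval_le_two_pow_edgeSize C).trans
    (Nat.pow_le_pow_right (by norm_num) ((Nat.le_add_right _ _).trans (edgeSize_add_size_le_length_encode n C)))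

/-- **`wt(C.eval) ≤ 2^(s · 2^s)`**, `s = |code C|`. [cite: Schwartz1980, §3] [cite: Burgisser2000TCS, Lemma 2.4 p. 77] -/
theorem weight_eval_le_two_pow_length_encode :
    weight C.eval ≤ 2 ^ ((encodeArithCircuit n C).length * 2 ^ (encodeArithCircuit n C).length) := by
  set s := (encodeArithCircuit n C).length with hs
  have h2s : 2 ≤ 2 ^ s :=
    calc 2 = 2 ^ 1 := by norm_num
      _ ≤ 2 ^ s := Nat.pow_le_pow_right (by norm_num) ((by norm_num : 1 ≤ 2).trans (two_le_length_encode n C))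
  calc weight C.eval ≤ (2 ^ s) ^ 2 ^ (C.edgeSize + C.size) :=
        weight_eval_le_of_constLe C h2s (constLe_two_pow_length_encode n C)
    _ ≤ (2 ^ s) ^ 2 ^ s := Nat.pow_le_pow_right (by positivity)
        (Nat.pow_le_pow_right (by norm_num) (edgeSize_add_size_le_length_encode n C))
    _ = 2 ^ (s * 2 ^ s) := by rw [← pow_mul]

/-- `s · 2^s ≤ 2^(2s)`. [folklore] -/
private theorem mul_two_pow_le_two_pow_two_mul (s : ℕ) : s * 2 ^ s ≤ 2 ^ (2 * s) := by
  rw [two_mul, pow_add]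
  exact Nat.mul_le_mul_right _ (Nat.lt_two_pow_self).le

/-- **`∑ |coeff C.eval| ≤ 2^(2^(2s))`**, `s = |code C|`: the hypothesis `hL1` of
`mem_coRP_of_modularZeroTest` with `h = 2X` (up to monotonicity in the input length), in its
`∑ |coeff|` currency. [cite: Schwartz1980, §3] [cite: Burgisser2000TCS, Lemma 2.4 p. 77] -/
theorem sum_abs_coeff_eval_le_of_length_encode :
    ∑ m ∈ C.eval.support, |C.eval.coeff m| ≤ (2 : ℤ) ^ 2 ^ (2 * (encodeArithCircuit n C).length) := by
  rw [← natCast_weight]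
  have h := (weight_eval_le_two_pow_length_encode n C).trans
    (Nat.pow_le_pow_right (by norm_num) (mul_two_pow_le_two_pow_two_mul _))
  exact_mod_cast h

end CodeForm

end ArithCircuit

end Literature.Computability.AlgebraicComplexity
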